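import Mathlib.Combinatorics.SimpleGraph.Bipartite
import Mathlib.Combinatorics.SimpleGraph.Connectivity.Connected
import Mathlib.Combinatorics.SimpleGraph.Hasse
import Mathlib.Analysis.SpecialFunctions.Log.Basic
import Literature.MathematicalPhysics.QuantumLattice.FinDimSpectrum
import Literature.MathematicalPhysics.QuantumLattice.SpinOperators
import Literature.MathematicalPhysics.QuantumLattice.SpinSystem
import Literature.MathematicalPhysics.QuantumLattice.HeisenbergModel
import Literature.MathematicalPhysics.QuantumLattice.LatticeTori
import Literature.MathematicalPhysics.QuantumLattice.LocalDynamics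
import Literature.MathematicalPhysics.QuantumLattice.MatrixProductStates
import HarnessLib
import HarnessLib.Audit

-- provenance: harness21/H21/H21/Statements/Hubbard/SpinChains.lean @ 966583b (interim HEAD d8f2665); M5 mechanical rewrite
/-!
# Quantum spin chains: Haldane, Lieb–Schultz–Mattis, AKLT, Marshall–Lieb–Mattis
(family `hubbard`, statements S02, S14, S15, S20, S21, S25)

Trunk QLatticeAQFT / family `hubbard`. Finite-volume statements about antiferromagnetic quantum
spin chains and bipartite Heisenberg antiferromagnets, phrased with the accepted prelude
vocabulary (`heisenbergRing`, `heisenbergHamiltonian`, `spinDot`, `siteSpin`, `totalSpin`,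
`totalSpinSq`, `spinZSector`, `lowestEnergyInSector`, `Matrix.groundEnergy/spectralGap/
HasSpectralGap/HasUniqueGroundState/IsGroundStateVector/groundStateDegeneracy/
groundStateFunctional/minEnergyOn`, `IsFrustrationFree`, `mpsPeriodic`, `akltTensor`,
`LatticeInteraction`, `rectTorusHamiltonian`):

* **hubbard.S21** (definition role: spin-`S` quantum spin systems, Heisenberg Hamiltonian, gap) on
  the contentful lemmas `sum_siteSpin_mul_siteSpin` (Casimir `𝐒_x² = S(S+1)`; the outline's
  `siteSpin_casimir`, renamed after its statement) and
  `commute_heisenbergRing_totalSpin` (`SU(2)` invariance of the ring);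
* **hubbard.S02** `HaldaneGapConjecture` (open; a `def … : Prop`, not asserted);
* **hubbard.S14** `lsm_affleck_lieb` (Lieb–Schultz–Mattis / Affleck–Lieb, gap `≤ C/L`);
* **hubbard.S15** the AKLT theorems `aklt_frustrationFree`, `aklt_isGroundStateVector_akltVBS`,
  `aklt_unique_periodic`, `aklt_open_degeneracy`, `aklt_gap`, `aklt_correlation_decay` for the
  AKLT ring `akltRing L` and open chain `akltOpenChain L`;
* **hubbard.S20** Marshall–Lieb–Mattis: `marshall_lieb_mattis_unique`, `marshall_lieb_mattis_spin`,
  `lieb_mattis_monotone`;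
* **hubbard.S25** `higherDim_lsm` (Hastings / Nachtergaele–Sims) on the rectangular torus
  `RectTorusSite ![L, W]`.

## Sources

* F. D. M. Haldane, Phys. Lett. A 93 (1983) 464; PRL 50 (1983) 1153; H. Tasaki, *Physics and
  Mathematics of Quantum Many-Body Systems* (Springer, 2020), Ch. 7–8, §2.4–2.5.
* E. Lieb, T. Schultz, D. Mattis, Ann. Phys. 16 (1961) 407, App. B; I. Affleck, E. H. Lieb,
  *A proof of part of Haldane's conjecture on spin chains*, Lett. Math. Phys. 12 (1986) 57, Thm 1.
* I. Affleck, T. Kennedy, E. H. Lieb, H. Tasaki, *Valence bond ground states in isotropic quantum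
  antiferromagnets*, Comm. Math. Phys. 115 (1988) 477, Thms 1–3 (numbering '?'), and PRL 59
  (1987) 799.
* E. Lieb, D. Mattis, *Ordering energy levels of interacting spin systems*, J. Math. Phys. 3
  (1962) 749, Thm 2; W. Marshall, Proc. R. Soc. A 232 (1955) 48; Tasaki (2020) §2.4, Thm 2.3.
* M. B. Hastings, *Lieb–Schultz–Mattis in higher dimensions*, Phys. Rev. B 69 (2004) 104431;
  B. Nachtergaele, R. Sims, *A multi-dimensional Lieb–Schultz–Mattis theorem*, Comm. Math. Phys.
  276 (2007) 437, Thm 1.1.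

## Mathlib / H21 status and design choices

* Mathlib has no quantum spin chains, spectral gaps of lattice Hamiltonians, AKLT/MPS or
  Lieb–Mattis vocabulary (searched `Haldane`, `AKLT`, `LiebMattis`, `heisenberg`, `spectralGap`:
  nothing relevant). Used from Mathlib: `SimpleGraph.IsBipartiteWith`, `SimpleGraph.Connected`,
  `Module.End.eigenspace` (through `spinZSector`), `ZMod.finEquiv`, `Filter.Tendsto`, `Real.exp`,
  `Real.log`. Everything else is from the accepted H21 prelude files imported above.
* Rings live on `ZMod L` and need `[NeZero L]` for finiteness; statements quantify
  `∀ (L : ℕ) [NeZero L], 2 ≤ L → …` (the instance binder is implied by `2 ≤ L` but must be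
  supplied to type-check `heisenbergRing L n`). For `L = 2` the ring `Σ_i 𝐒_i · 𝐒_{i+1}` counts the
  single bond `{0, 1}` twice (review F12c; see `heisenbergRing`); we keep `∀ L ≥ 2` following the
  texts and say so in the docstrings.
* AKLT at `L = 2`: `akltRing 2 = 2 h₀₁` with `h = 𝐒·𝐒 + ⅓(𝐒·𝐒)²`, whose eigenvalues on two
  spin-1's are `-2/3, -2/3, 4/3` (bond spin `0, 1, 2`), so the ground space of `akltRing 2` is the
  four-dimensional bond-spin `0 ⊕ 1` sector: uniqueness and the (uniqueness-including) uniform gap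
  fail at `L = 2`. Hence `aklt_unique_periodic` and `aklt_gap` assume `3 ≤ L`, while
  frustration-freeness, `IsGroundStateVector (akltVBS 2)`, the open-chain four-fold degeneracy and
  the parent-Hamiltonian bridge hold (and are stated) for `2 ≤ L`.
* The AKLT Hamiltonians are written directly as bond sums (`akltBond`, which duplicates the
  per-edge term of the prelude's `biquadraticHamiltonian`), like `heisenbergRing` /
  `heisenbergOpenChain`, rather than as instances of the prelude's graph Hamiltonian
  `QLattice.akltHamiltonian G = biquadraticHamiltonian 2 G 1 (1/3)`, because several ring
  statements are quantified `∀ L ≥ 2` and the simple graph `torusGraph 1 2` has only one edge.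
  The bridges
  `akltRing_eq_reindexOp_akltHamiltonian_torusGraph` (`3 ≤ L`, along `Fin 1 → ZMod L ≃ ZMod L`,
  exactly as `heisenbergRing_eq_heisenbergHamiltonian_torusGraph`) and
  `akltOpenChain_eq_akltHamiltonian_pathGraph` (Mathlib's `SimpleGraph.pathGraph L` on `Fin L`)
  tie them to the prelude notion. `akltRingInteraction` packages the ring as an
  `Interaction (ZMod L) 3` so that `IsFrustrationFree` applies
  (`localHamiltonian_akltRingInteraction`), and `parentHamiltonian_akltTensor_eq_akltRing` links
  it to the MPS parent Hamiltonian of Q9. `akltVBS L` has literally the same body as `ringMPS L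
  akltTensor` of the sibling `H21/Statements/Hubbard/LiebRobinson.lean` (neither statement file
  imports the other); if `ringMPS` is lifted into `Prelude/QLatticeAQFT/MatrixProductStates.lean`,
  `akltVBS L` should become `ringMPS L akltTensor`.
* The AKLT ground-state correlation is `re (groundStateFunctional (akltRing L) (𝐒_0 · 𝐒_x))`
  (tracial ground-state functional = the unique ground state, by `aklt_unique_periodic`), as a total
  function of `L : ℕ` with junk value `0` at `L = 0`; its `L → ∞` limit is `4 · (-1/3)^x`
  (AKLT (1988) Thm 3 / eq. (2.15): `⟨S^a_0 S^a_x⟩ = (4/3)(-1/3)^x` per component). Only the limit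
  is stated; the exact finite-`L` formula with its `(-1/3)^L` corrections is deliberately omitted.
* `HaldaneGapConjecture` keeps the outline's shape (correlations of normalised ground-state
  *vectors*, of which there is exactly one up to phase under the gap clause) rather than the
  `groundStateFunctional` phrasing used for AKLT; the two are equivalent there.
* Marshall–Lieb–Mattis: "unique lowest state in the sector `Sᶻ_tot = M`" is phrased variationally
  through `lowestEnergyInSector = minEnergyOn H (spinZSector M)`: the sector minimum is attained,
  and any two normalised minimisers are proportional. Allowed magnetisations are those with
  `spinZSector n M ≠ ⊥`. The total spin of the absolute ground states is expressed as the
  eigenvalue `S₀(S₀+1)` of `totalSpinSq`. Lieb–Mattis monotonicity is stated in its contentful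
  strict form `E(M) < E(M')` for `S₀ ≤ |M| < |M'|` (the non-strict form is a triviality of `SU(2)`
  invariance) together with `E(M) = E₀` for `|M| ≤ S₀`.
* `higherDim_lsm` is on the rectangular torus `RectTorusSite ![L, W]` (review F11) with the
  instance binder `[∀ i, NeZero (![L, W] i)]` (equivalent to `L ≠ 0 ∧ W ≠ 0`, implied by the
  hypotheses but needed to write `rectTorusHamiltonian`). A spin symmetry is essential (without
  it the on-site field `-Σ_x σᶻ_x` is a finite-range, bounded, Hermitian, translation-invariant
  counterexample with unique ground state and gap `2`): we assume global `SU(2)` invariance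
  `Φ.IsRotationInvariant`, as in Hastings (2004) and in the main formulation of Nachtergaele–Sims
  (2007) Thm 1.1; both theorems hold more generally under a `U(1)` symmetry with an `Sᶻ_tot = 0`
  ground state, which we do not formalise. (The outline sketch listed no symmetry hypothesis and
  its gloss "SU(2) invariance is not a hypothesis" referred to this `U(1)` generalisation; the
  symmetry-free statement is false, review r01819A.) In the degenerate cross-section `W = 1`, where
  `rectTorusInteraction` keeps only on-site terms, `SU(2)`-invariant on-site terms are scalars, so
  the ground state is never unique and the implication is vacuous (not false) there. The bound
  `C log L / L` is for the gap in the *long* direction: we require the aspect condition `W ≤ L`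
  (Hastings' proviso that the transverse extent is at most a fixed multiple of `L`; with it the
  constant `C` depends only on `Φ`), rather than silently claiming the bound also for `W ≫ L`.
-/

noncomputable section

open Filter Finset Matrix Complex
open scoped Topology
open Literature.MathematicalPhysics.QuantumLattice

namespace Literature.MathematicalPhysics.QuantumLattice

/-! ### hubbard.S21: spin systems, Casimir, `SU(2)` invariance of the ring -/

section SpinSystem

variable {Λ : Type*} [Fintype Λ] [DecidableEq Λ]

/-- **hubbard.S21** (definition role: spin-`S` quantum spin system on a finite `Λ`,
`𝓗_Λ = ⨂_x ℂ^{2S+1}`, site spin operators; Tasaki (2020) §2.1–2.2, eq. (2.2.7);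
Bratteli–Robinson II §6.2.1). The on-site Casimir identity `𝐒_x · 𝐒_x = Σ_α (S^α_x)² = S(S+1) 𝟙`
with `S = n/2`, i.e. each site carries the irreducible spin-`S` representation of `su(2)`
(`spinCasimir_eq` transported along `onSite x`). [cite: Tasaki2020] -/
def sum_siteSpin_mul_siteSpin : Prop :=
  ∀ (n : ℕ) (x : Λ),
    ∑ α : Fin 3, (siteSpin n x α : Op Λ (n + 1)) * siteSpin n x α =
      ((n : ℂ) / 2 * ((n : ℂ) / 2 + 1)) • (1 : Op Λ (n + 1))

/-- **hubbard.S21** (definition role: Heisenberg Hamiltonian `H = Σ_{⟨xy⟩} J_{xy} 𝐒_x · 𝐒_y`, its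
ground-state energy and gap `E₁ - E₀`; Tasaki (2020) §2.2, §2.5, eq. (2.5.2), App. A). The
antiferromagnetic Heisenberg ring `heisenbergRing L n = Σ_{i ∈ ℤ/L} 𝐒_i · 𝐒_{i+1}` is
`SU(2)`-invariant: it commutes with every component of the total spin. (The graph version is
`QLattice.commute_heisenberg_totalSpin`; the gap vocabulary is `Matrix.spectralGap`,
`Matrix.HasSpectralGap` of `FinDimSpectrum`.) [cite: Tasaki2020] -/
def commute_heisenbergRing_totalSpin : Prop :=
  ∀ (L : ℕ) [NeZero L] (n : ℕ) (α : Fin 3),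
    Commute (heisenbergRing L n) (totalSpin n α)

/-- **hubbard.S21** (definition role; Tasaki (2020) §2.2, App. A.2). The Heisenberg ring is
Hermitian, so its ground-state energy `Matrix.groundEnergy` is its lowest eigenvalue and
`Matrix.spectralGap` is `E₁ - E₀`. [cite: Tasaki2020] -/
theorem heisenbergRing_isHermitian (L : ℕ) [NeZero L] (n : ℕ) :
    (heisenbergRing L n).IsHermitian := by
  unfold heisenbergRing
  rw [IsHermitian, conjTranspose_sum]
  exact Finset.sum_congr rfl fun i _ => (spinDot_isHermitian n i (i + 1)).eq

end SpinSystem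

/-! ### hubbard.S02: the Haldane gap conjecture -/

/-- **hubbard.S02** (Haldane gap conjecture; Haldane, Phys. Lett. A 93 (1983) 464, PRL 50 (1983)
1153; Affleck, J. Phys.: Condens. Matter 1 (1989) 3047; Tasaki (2020) Ch. 7–8; **open**, numerics
`γ ≈ 0.4105`). For the spin-`1` antiferromagnetic Heisenberg ring
`H_L = Σ_{i ∈ ℤ/L} 𝐒_i · 𝐒_{i+1}` on `(ℂ³)^{⊗L}` there is `γ > 0` such that for all `L` the ground
state is unique with gap `E₁(L) - E₀(L) ≥ γ` (`Matrix.HasSpectralGap`), and the ground-state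
correlations `⟨ψ_L, 𝐒_0 · 𝐒_x ψ_L⟩` decay exponentially in `x`, uniformly in `L`.
The quantifier `∀ L ≥ 2` follows the text; note that for `L = 2` the ring `heisenbergRing 2 2`
counts the single bond `{0, 1}` twice (review F12c), which does not affect uniqueness or the
existence of a uniform gap. The correlation clause quantifies over normalised ground-state
vectors `ψ_L`; under the first clause there is exactly one up to a phase, so this equals the
ground-state expectation `groundStateFunctional (heisenbergRing L 2) (𝐒_0 · 𝐒_x)`.
Stated as a `Prop`; not asserted. [cite: Tasaki2020] -/
@[conjecture] def HaldaneGapConjecture : Prop :=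
  (∃ γ > 0, ∀ (L : ℕ) [NeZero L], 2 ≤ L → (heisenbergRing L 2).HasSpectralGap γ) ∧
    ∃ C ξ : ℝ, 0 < ξ ∧ ∀ (L : ℕ) [NeZero L], 2 ≤ L →
      ∀ ψ : TensorIndex (ZMod L) 3 → ℂ, (heisenbergRing L 2).IsGroundStateVector ψ →
        star ψ ⬝ᵥ ψ = 1 → ∀ x : ℕ, 2 * x ≤ L →
          |(star ψ ⬝ᵥ (spinDot 2 (0 : ZMod L) (x : ZMod L) *ᵥ ψ)).re| ≤ C * Real.exp (-x / ξ)

/-! ### hubbard.S14: Lieb–Schultz–Mattis / Affleck–Lieb -/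

/-- **hubbard.S14** (Lieb–Schultz–Mattis theorem, Affleck–Lieb form; Lieb–Schultz–Mattis, Ann.
Phys. 16 (1961) 407, App. B; Affleck–Lieb, Lett. Math. Phys. 12 (1986) 57, Thm 1). For the
half-odd-integer-spin (`n` odd, `S = n/2`) antiferromagnetic Heisenberg ring of even length `L`,
if the ground state is unique then there is an excited state with `E₁ - E₀ ≤ C/L`, with `C`
independent of `L`; hence there is no uniform gap with a unique ground state.
[cite: AffleckLiebLMP1986, Thm. 1] -/
def lsm_affleck_lieb : Prop :=
  ∀ (n : ℕ) (hn : Odd n),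
    ∃ C : ℝ, ∀ (L : ℕ) [NeZero L], Even L → 2 ≤ L →
      (heisenbergRing L n).HasUniqueGroundState → (heisenbergRing L n).spectralGap ≤ C / L

/-! ### hubbard.S15: the AKLT model -/

section AKLT

variable {Λ : Type*} [Fintype Λ] [DecidableEq Λ]

/-- The AKLT bond term `h_{xy} = 𝐒_x · 𝐒_y + ⅓ (𝐒_x · 𝐒_y)²` (spin `1`); it equals `2 P₂(x,y) - 2/3`
with `P₂` the projection onto bond spin `2`, so its ground energy is `-2/3`.
AKLT, CMP 115 (1988), eq. (1.2); Tasaki (2020) §7.1, eq. (7.1.1). [cite: Tasaki2020] -/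
def akltBond (x y : Λ) : Op Λ 3 :=
  spinDot 2 x y + (1 / 3 : ℂ) • (spinDot 2 x y * spinDot 2 x y)

/-- The AKLT bond term is Hermitian. AKLT (1988) §1. [cite: AKLT1988] -/
theorem akltBond_isHermitian (x y : Λ) : (akltBond x y).IsHermitian := by
  have h := (spinDot_isHermitian (Λ := Λ) 2 x y).eq
  unfold akltBond
  refine IsHermitian.add (spinDot_isHermitian 2 x y) (IsHermitian.smul ?_ ?_)
  · rw [IsHermitian, conjTranspose_mul, h]
  · rw [isSelfAdjoint_iff, Complex.star_def, map_div₀, map_one, map_ofNat]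

/-- The periodic **AKLT ring** `H_L = Σ_{i ∈ ℤ/L} (𝐒_i · 𝐒_{i+1} + ⅓ (𝐒_i · 𝐒_{i+1})²)` on `L`
spin-`1` sites (as for `heisenbergRing`, the case `L = 2` double-counts the bond `{0,1}` — its
ground space is then the four-dimensional bond-spin `0 ⊕ 1` sector, so uniqueness and gap
statements assume `3 ≤ L`, the others `2 ≤ L` — and `L = 1` is an on-site term). AKLT, CMP 115
(1988), eq. (1.2); Tasaki (2020) §7.1. [cite: Tasaki2020] -/
def akltRing (L : ℕ) [NeZero L] : Op (ZMod L) 3 :=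
  ∑ i : ZMod L, akltBond i (i + 1)

/-- The **open AKLT chain** `H = Σ_{i=0}^{L-2} (𝐒_i · 𝐒_{i+1} + ⅓ (𝐒_i · 𝐒_{i+1})²)` on `Fin L`
(free boundary conditions; constrained double sum, no `Fin` arithmetic). AKLT, CMP 115 (1988),
§2; Tasaki (2020) §7.1. [cite: Tasaki2020] -/
def akltOpenChain (L : ℕ) : Op (Fin L) 3 :=
  ∑ i : Fin L, ∑ j : Fin L, if i.val + 1 = j.val then akltBond i j else 0

/-- Bridge to the prelude notion: for `3 ≤ L` the AKLT ring on `ℤ/Lℤ` is the graph AKLT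
Hamiltonian `QLattice.akltHamiltonian` on the one-dimensional torus graph
`Literature.StatMech.torusGraph 1 L` (vertex type `Fin 1 → ZMod L`), transported along
`Fin 1 → ZMod L ≃ ZMod L`; compare `heisenbergRing_eq_heisenbergHamiltonian_torusGraph`. (For
`L = 2` the torus graph has one edge while the ring counts it twice.) AKLT, CMP 115 (1988),
eq. (1.2); Tasaki (2020) §7.1. [cite: Tasaki2020] -/
def akltRing_eq_reindexOp_akltHamiltonian_torusGraph : Prop :=
  ∀ (L : ℕ) [NeZero L] (hL : 3 ≤ L),
    akltRing L =
      reindexOp (Equiv.funUnique (Fin 1) (ZMod L))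
        (akltHamiltonian (Literature.Probability.LatticeModels.torusGraph 1 L))

/-- Bridge to the prelude notion: the open AKLT chain on `Fin L` is the graph AKLT Hamiltonian
`QLattice.akltHamiltonian` on Mathlib's path graph `SimpleGraph.pathGraph L`. The instance binder
`[DecidableRel (SimpleGraph.pathGraph L).Adj]` is needed by `akltHamiltonian`; the statement holds
for any instance (adjacency `i + 1 = j ∨ j + 1 = i`, `SimpleGraph.pathGraph_adj`), so it is kept
as a binder rather than fixed classically. AKLT, CMP 115 (1988), §2; Tasaki (2020) §7.1. [cite: Tasaki2020] -/
def akltOpenChain_eq_akltHamiltonian_pathGraph : Prop :=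
  ∀ (L : ℕ) [DecidableRel (SimpleGraph.pathGraph L).Adj],
    akltOpenChain L = akltHamiltonian (SimpleGraph.pathGraph L)

/-- The AKLT ring as an `Interaction (ZMod L) 3`: the region `X` carries `Σ_{i : X = {i, i+1}} h_{i,i+1}`
(so nearest-neighbour pairs carry their bond term and all other regions carry `0`; for `L = 2`
the region `{0,1}` carries both bond terms, matching `akltRing`). Used to phrase
frustration-freeness via `QLattice.IsFrustrationFree`. AKLT (1988) §1; Tasaki (2020) §7.1. [cite: AKLT1988] -/
def akltRingInteraction (L : ℕ) [NeZero L] : Interaction (ZMod L) 3 :=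
  Interaction.mk fun X => ∑ i : ZMod L, if X = {i, i + 1} then akltBond i (i + 1) else 0

/-- The local Hamiltonian of `akltRingInteraction L` on the whole ring is `akltRing L`.
AKLT (1988) §1. [cite: AKLT1988] -/
theorem localHamiltonian_akltRingInteraction (L : ℕ) [NeZero L] :
    localHamiltonian (akltRingInteraction L) univ = akltRing L := by
  unfold localHamiltonian akltRingInteraction akltRing
  simp only [Interaction.mk_apply, powerset_univ]
  rw [Finset.sum_comm]
  exact Finset.sum_congr rfl fun i _ => by rw [Finset.sum_ite_eq' univ, if_pos (mem_univ _)]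

/-- The AKLT ring is Hermitian. AKLT (1988) §1. [cite: AKLT1988] -/
theorem akltRing_isHermitian (L : ℕ) [NeZero L] : (akltRing L).IsHermitian := by
  unfold akltRing
  rw [IsHermitian, conjTranspose_sum]
  exact Finset.sum_congr rfl fun i _ => (akltBond_isHermitian i (i + 1)).eq

/-- Link with the MPS parent Hamiltonian of `Literature.Prelude.QLatticeAQFT.MatrixProductStates`: for
`2 ≤ L`, `parentHamiltonian L 2 akltTensor = Σ_i P₂(i,i+1) = ½ H_AKLT + L/3`
(`parentHamiltonian_akltTensor_eq`). AKLT (1988) §2; Fannes–Nachtergaele–Werner, CMP 144 (1992)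
§7; Tasaki (2020) §7.1. [cite: AKLT1988] -/
def parentHamiltonian_akltTensor_eq_akltRing : Prop :=
  ∀ (L : ℕ) [NeZero L] (hL : 2 ≤ L),
    parentHamiltonian L 2 akltTensor =
      (1 / 2 : ℂ) • akltRing L + ((L : ℂ) / 3) • (1 : Op (ZMod L) 3)

/-- The AKLT valence-bond-solid state on the ring `ℤ/L`: the periodic matrix product state of the
AKLT tensor, `Ω_L(σ) = tr (A^{σ₀} ⋯ A^{σ_{L-1}})`, with sites of `ℤ/L` enumerated by
`ZMod.finEquiv`. This is literally `ringMPS L akltTensor` for the `ringMPS` of the sibling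
statement file `H21/Statements/Hubbard/LiebRobinson.lean` (same body; intra-H21 duplicate, to be
merged if `ringMPS` is lifted into the MPS prelude). AKLT (1988) §2, eq. (2.3);
Fannes–Nachtergaele–Werner (1992) §7. [cite: AKLT1988] -/
def akltVBS (L : ℕ) [NeZero L] : TensorIndex (ZMod L) 3 → ℂ :=
  fun σ => mpsPeriodic L akltTensor (σ ∘ ZMod.finEquiv L)

/-- The ground-state correlation `⟨𝐒_0 · 𝐒_x⟩_L = re tr(P₀ 𝐒_0 · 𝐒_x)/tr P₀` of the AKLT ring of
length `L` in its (tracial) ground-state functional — for `3 ≤ L` the expectation in the unique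
ground state `Ω_L` (`aklt_unique_periodic`) — at lattice distance `x : ℕ` (site `x mod L`; for
`L ≤ x` the site wraps around the ring, harmless for the `L → ∞` limit at fixed `x`).
**Junk value** `0` at `L = 0`. AKLT (1988) Thm 3 / §2. [cite: AKLT1988] -/
def akltRingCorr (L x : ℕ) : ℝ :=
  if hL : L = 0 then 0
  else
    haveI : NeZero L := ⟨hL⟩
    ((akltRing L).groundStateFunctional (spinDot 2 (0 : ZMod L) (x : ZMod L))).re

/-- Unfolding `akltRingCorr` for `L ≠ 0`. [folklore] -/
theorem akltRingCorr_of_neZero (L : ℕ) [NeZero L] (x : ℕ) :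
    akltRingCorr L x =
      ((akltRing L).groundStateFunctional (spinDot 2 (0 : ZMod L) (x : ZMod L))).re := by
  simp [akltRingCorr, NeZero.ne L]

/-- **hubbard.S15** (AKLT, frustration-freeness; Affleck–Kennedy–Lieb–Tasaki, PRL 59 (1987) 799;
CMP 115 (1988) 477, Thm 1 and §2; Tasaki (2020) §7.1, Thm 7.1). The AKLT ring is frustration-free:
its ground energy is the sum `-2L/3` of the ground energies of its bond terms, i.e. the ground
state minimises every `h_{i,i+1} = 2P₂(i,i+1) - 2/3` simultaneously (`2 ≤ L`). [cite: Tasaki2020] -/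
def aklt_frustrationFree : Prop :=
  ∀ (L : ℕ) [NeZero L] (hL : 2 ≤ L),
    IsFrustrationFree (akltRingInteraction L) univ ∧
      (akltRing L).groundEnergy = -(2 * (L : ℝ) / 3)

/-- **hubbard.S15** (AKLT, the VBS state is a ground state; AKLT, CMP 115 (1988) 477, Thm 1 ('?':
numbering) and §2; Tasaki (2020) §7.1.2). For `2 ≤ L` the valence-bond-solid / matrix product
state `akltVBS L` is a (nonzero) ground-state vector of the AKLT ring: it is annihilated by every
bond projection `P₂(i,i+1)`. (True also at `L = 2`, where the ground space is four-dimensional.) [cite: Tasaki2020] -/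
def aklt_isGroundStateVector_akltVBS : Prop :=
  ∀ (L : ℕ) [NeZero L] (hL : 2 ≤ L),
    (akltRing L).IsGroundStateVector (akltVBS L)

/-- **hubbard.S15** (AKLT, unique periodic ground state; AKLT, CMP 115 (1988) 477, Thm 1 ('?':
numbering); Fannes–Nachtergaele–Werner (1992) §7; Tasaki (2020) Thm 7.2). For `3 ≤ L` the AKLT
ring has a unique ground state, namely (by `aklt_isGroundStateVector_akltVBS`) the VBS state
`akltVBS L`. The hypothesis `3 ≤ L` is sharp: `akltRing 2 = 2h₀₁` has the four-dimensional
ground space of bond spin `0 ⊕ 1` (eigenvalue `-2/3` of `h`).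
[cite: FannesNachtergaeleWerner1992] -/
def aklt_unique_periodic : Prop :=
  ∀ (L : ℕ) [NeZero L] (hL : 3 ≤ L),
    (akltRing L).HasUniqueGroundState

/-- **hubbard.S15** (AKLT, open chain; AKLT, CMP 115 (1988) 477, Thm 1 and §2 ('?': numbering);
Tasaki (2020) Thm 7.3). For `2 ≤ L` the open AKLT chain on `L` sites has an exactly four-fold
degenerate ground space (spanned by the MPS `mpsOpen L akltTensor l r`, i.e. the two free
boundary spin-1/2's), of energy `-2(L-1)/3`. [cite: Tasaki2020] -/
def aklt_open_degeneracy : Prop :=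
  ∀ (L : ℕ) (hL : 2 ≤ L),
    (akltOpenChain L).groundStateDegeneracy = 4 ∧
      (akltOpenChain L).groundEnergy = -(2 * ((L : ℝ) - 1) / 3)

/-- **hubbard.S15** (AKLT, uniform spectral gap; AKLT, CMP 115 (1988) 477, Thm 2 ('?': numbering);
Tasaki (2020) Thm 7.5; Fannes–Nachtergaele–Werner (1992) Thm 6.4). The AKLT ring has a unique
ground state and a spectral gap bounded below uniformly in the length: `∃ γ > 0`, for all
`L ≥ 3`, `E₁(L) - E₀(L) ≥ γ` (`Matrix.HasSpectralGap`, which includes uniqueness of the ground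
state; hence `3 ≤ L`, the doubled bond `akltRing 2` having a four-fold ground space). [cite: Tasaki2020] -/
def aklt_gap : Prop :=
  ∃ γ > 0, ∀ (L : ℕ) [NeZero L], 3 ≤ L → (akltRing L).HasSpectralGap γ

/-- **hubbard.S15** (AKLT, exponential decay of correlations; AKLT, CMP 115 (1988) 477, Thm 3 and
eq. (2.15) ('?': numbering); Tasaki (2020) §7.1.3). The ground-state correlations of the AKLT ring
decay as `(-1/3)^x` (correlation length `ξ = 1/ln 3`): for every `x ≥ 1`,
`⟨𝐒_0 · 𝐒_x⟩_L → 4 · (-1/3)^x` as `L → ∞` (per component `⟨S^a_0 S^a_x⟩ = (4/3)(-1/3)^x`).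
Only the `L → ∞` limit (pointwise in `x`) is stated; the exact finite-`L` formula of AKLT (1988)
eq. (2.15), with its `(-1/3)^L` wrap-around corrections, is deliberately not recorded. [cite: Tasaki2020] -/
def aklt_correlation_decay : Prop :=
  ∀ (x : ℕ) (hx : 1 ≤ x),
    Tendsto (fun L : ℕ => akltRingCorr L x) atTop (𝓝 (4 * (-1 / 3 : ℝ) ^ x))

end AKLT

/-! ### hubbard.S20: Marshall–Lieb–Mattis -/

section LiebMattis

variable {Λ : Type*} [Fintype Λ] [DecidableEq Λ]

/-- The Lieb–Mattis ground-state spin `S₀ = |(|A| S_A - |B| S_B)| = |(|A| - |B|)| · n/2` of a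
bipartite spin-`n/2` antiferromagnet with sublattices `A` and `B = Aᶜ` (all sites carry the same
spin `S_A = S_B = n/2`). Lieb–Mattis, J. Math. Phys. 3 (1962) 749, Thm 2; Tasaki (2020) Thm 2.3. [cite: Tasaki2020] -/
def liebMattisSpin (n : ℕ) (A : Finset Λ) : ℝ :=
  |((A.card : ℝ) - (Aᶜ.card : ℝ))| * n / 2

/-- `S₀ ≥ 0`. Lieb–Mattis (1962). [cite: LiebMattis1962] -/
theorem liebMattisSpin_nonneg (n : ℕ) (A : Finset Λ) : 0 ≤ liebMattisSpin n A := by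
  unfold liebMattisSpin
  positivity

variable (n : ℕ) (G : SimpleGraph Λ) [DecidableRel G.Adj] (A : Finset Λ) (J : ℝ)

/-- **hubbard.S20** (Marshall–Lieb–Mattis, uniqueness in each `Sᶻ` sector; Lieb–Mattis, J. Math.
Phys. 3 (1962) 749, Thm 2; Marshall, Proc. R. Soc. A 232 (1955) 48; Tasaki (2020) §2.4, Thm 2.3).
For the spin-`n/2` Heisenberg antiferromagnet (`J > 0`) on a finite connected bipartite graph with
sublattices `A`, `Aᶜ`, in each non-trivial magnetisation sector `Sᶻ_tot = M` the lowest energy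
`E(M) = lowestEnergyInSector` is attained by a state which is unique up to a phase (any two
normalised minimisers in the sector are proportional); moreover it can be chosen with amplitudes
`marshallSign A σ · (positive)` in the product basis (Marshall sign rule, recorded here only in the
docstring). [cite: Tasaki2020] -/
def marshall_lieb_mattis_unique : Prop :=
  ∀ (hG : G.Connected) (hA : G.IsBipartiteWith (A : Set Λ) (↑A)ᶜ) (hJ : 0 < J) (M : ℝ) (hM : spinZSector (Λ := Λ) n M ≠ ⊥),
    ∃ ψ ∈ spinZSector (Λ := Λ) n M, star ψ ⬝ᵥ ψ = 1 ∧
      (star ψ ⬝ᵥ (heisenbergHamiltonian n G J *ᵥ ψ)).re =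
        lowestEnergyInSector n (heisenbergHamiltonian n G J) M ∧
      ∀ φ ∈ spinZSector (Λ := Λ) n M, star φ ⬝ᵥ φ = 1 →
        (star φ ⬝ᵥ (heisenbergHamiltonian n G J *ᵥ φ)).re =
          lowestEnergyInSector n (heisenbergHamiltonian n G J) M →
        ∃ c : ℂ, φ = c • ψ

/-- **hubbard.S20** (Marshall–Lieb–Mattis, spin of the ground state; Lieb–Mattis, J. Math. Phys. 3
(1962) 749, Thm 2; Tasaki (2020) Thm 2.3). For the spin-`n/2` Heisenberg antiferromagnet
(`J > 0`) on a finite connected bipartite graph with sublattices `A`, `Aᶜ`, every (absolute) ground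
state has total spin `S₀ = |(|A| - |Aᶜ|)| n/2` (`= 0` when `|A| = |Aᶜ|`), i.e. is an eigenvector
of `(𝐒_tot)²` with eigenvalue `S₀(S₀+1)`, and the ground space has dimension exactly `2S₀ + 1`. [cite: Tasaki2020] -/
def marshall_lieb_mattis_spin : Prop :=
  ∀ (hG : G.Connected) (hA : G.IsBipartiteWith (A : Set Λ) (↑A)ᶜ) (hJ : 0 < J),
    (∀ ψ : TensorIndex Λ (n + 1) → ℂ, (heisenbergHamiltonian n G J).IsGroundStateVector ψ →
      totalSpinSq n *ᵥ ψ =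
        ((liebMattisSpin n A * (liebMattisSpin n A + 1) : ℝ) : ℂ) • ψ) ∧
    ((heisenbergHamiltonian n G J).groundStateDegeneracy : ℝ) = 2 * liebMattisSpin n A + 1

/-- **hubbard.S20** (Lieb–Mattis ordering of energy levels; Lieb–Mattis, J. Math. Phys. 3 (1962)
749, Thm 2; Tasaki (2020) Thm 2.3 and eq. (2.4.7)). For the spin-`n/2` Heisenberg antiferromagnet
(`J > 0`) on a finite connected bipartite graph with sublattices `A`, `Aᶜ` and `S₀ = liebMattisSpin`,
the sector energies `E(M) = lowestEnergyInSector` satisfy: `E(M) = E₀` for `|M| ≤ S₀`, and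
`E(M) < E(M')` whenever `S₀ ≤ |M| < |M'|` (non-trivial sectors); equivalently the lowest energy
`E(S)` among states of total spin `S` is strictly increasing for `S ≥ S₀`. (Non-strict monotonicity
in `|M|` alone is a triviality of `SU(2)` invariance and is not the content.) [cite: Tasaki2020] -/
def lieb_mattis_monotone : Prop :=
  ∀ (hG : G.Connected) (hA : G.IsBipartiteWith (A : Set Λ) (↑A)ᶜ) (hJ : 0 < J),
    (∀ M : ℝ, spinZSector (Λ := Λ) n M ≠ ⊥ → |M| ≤ liebMattisSpin n A →
      lowestEnergyInSector n (heisenbergHamiltonian n G J) M =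
        (heisenbergHamiltonian n G J).groundEnergy) ∧
    ∀ M M' : ℝ, spinZSector (Λ := Λ) n M ≠ ⊥ → spinZSector (Λ := Λ) n M' ≠ ⊥ →
      liebMattisSpin n A ≤ |M| → |M| < |M'| →
        lowestEnergyInSector n (heisenbergHamiltonian n G J) M <
          lowestEnergyInSector n (heisenbergHamiltonian n G J) M'

end LiebMattis

/-! ### hubbard.S25: Lieb–Schultz–Mattis in higher dimensions -/

/-- **hubbard.S25** (higher-dimensional Lieb–Schultz–Mattis; Hastings, Phys. Rev. B 69 (2004)
104431; Nachtergaele–Sims, Comm. Math. Phys. 276 (2007) 437, Thm 1.1). Let `Φ` be a finite-range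
(`R`), bounded (`J`), Hermitian, translation-invariant and `SU(2)`-invariant
(`Φ.IsRotationInvariant`) interaction of spin-1/2's on `ℤ²` (local dimension `q = 2 = 1 + 1`, one
site per unit cell, so an odd number `W` of spin-1/2's per rung). Then there
is `C` (depending only on `Φ`) such that on every rectangular torus `ℤ/L × ℤ/W` with `W` odd,
`L ≥ 2` and `W ≤ L` (`rectTorusHamiltonian Φ ![L, W]` on `RectTorusSite ![L, W]`, periodic
boundary conditions, review F11), if the ground state is unique then the gap satisfies
`E₁ - E₀ ≤ C log L / L`. The aspect hypothesis `W ≤ L` says that `L` is the long direction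
(Hastings' proviso; Nachtergaele–Sims Thm 1.1 fixes the cross-section and lets `L → ∞`, which
this uniform-in-`W ≤ L` form implies); without it the statement would be stronger than the cited
theorems. A spin symmetry **is** a hypothesis: `SU(2)` invariance is assumed (as in Hastings and
in Nachtergaele–Sims Thm 1.1); the theorems hold more generally under a `U(1)` symmetry with an
`Sᶻ_tot = 0` ground state, not formalised here. Without any symmetry the statement is false
(on-site field `-Σ σᶻ_x`: unique ground state, gap `2`). For `W = 1` the finite-volume
interaction keeps only on-site terms, which are scalars by `SU(2)` invariance, so uniqueness fails
and the implication is vacuous there. The instance binder `[∀ i, NeZero (![L, W] i)]` (i.e.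
`L, W ≠ 0`, implied by `2 ≤ L` and `Odd W`) is needed to form the finite torus. (Name as planned
in the outline; Mathlib style would be `lsm_higher_dimensional`.)
[cite: NachtergaeleSimsCMP2007, Thm. 1.1] -/
def higherDim_lsm : Prop :=
  ∀ (Φ : LatticeInteraction 2 2) (R J : ℝ) (hR : Φ.HasFiniteRange R) (hJ : Φ.IsBounded J) (hH : Φ.IsHermitian) (hT : Φ.IsTranslationInvariant) (hrot : Φ.IsRotationInvariant),
    ∃ C : ℝ, ∀ (L W : ℕ) [∀ i, NeZero (![L, W] i)], Odd W → 2 ≤ L → W ≤ L →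
      (rectTorusHamiltonian Φ ![L, W]).HasUniqueGroundState →
        (rectTorusHamiltonian Φ ![L, W]).spectralGap ≤ C * Real.log L / L

end Literature.MathematicalPhysics.QuantumLattice
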